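import Summits.NavierStokesRegularity.NavierStokesRegularity.Theorems.ExtremiserTransienceNearExtremalTransienceExtremiserLiouvilleConstantSpeedSlideGenerator
import Literature.Analysis.FluidPDE.VorticityCalculus
import HarnessLib

/-!
# Crux `ExtremiserTransience.NearExtremalTransience` (stmt-NavierStokesRegularity-21883), line `extremiser_liouville`,
# stub K1b — THE ENSTROPHY VARIATION ALONG THE PIOLA SLIDE, pointwise

`--supports stmt-NavierStokesRegularity-21883` (helper).  Author: prover seat `ns-el-k1b` (g8).  Record:
`Cruxes/NearExtremalTransience/Lines/extremiser_liouville_k1b_slide.md` §2 (identity (A), curl form).  Continues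
`…ConstantSpeedPiolaSlide`, `…ConstantSpeedSlideGenerator`.

For the generator `φ_g = g(x₂)∂₂V + g′(x₂)V_h` (`V_h = V − V₂e₂`) of the vertical Piola slide, the integrand of the enstrophy
variation `a₁(φ_g) = ∫⟪curl V, curl φ_g⟫` is, POINTWISE (`V, g ∈ C²`; `ω = curl V`, `P = ∂₂V`, `∂ⱼV₂ = (DV eⱼ)₂`):
```
  curl φ_g = g·curl(∂₂V) + g′·(−2P₁, 2P₀, ω₂) + g″·(−V₁, V₀, 0),
  ⟪ω, curl φ_g⟫ = g(x₂)·⟪ω, curl(∂₂V)⟫ + g′(x₂)·( 2|∂₂V_h|² − 2⟪∇_hV₂, ∂₂V_h⟫ + ω₂² ) + g″(x₂)·( ⟪V_h, ∂₂V_h⟫ − ⟪V_h, ∇_hV₂⟫ )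
```
(`curl_slideGenerator_apply`, `inner_curl_slideGenerator`), and `curl(∂₂V) = ∂₂(curl V)` (`curl_fderiv_apply_comm`).  Integrated
against `dx` with the axial rule `∫g⟪ω,∂₂ω⟫ = −½∫g′‖ω‖²` (…SlideGenerator) and `‖ω‖² = |∇_hV₂|² + |∂₂V_h|² − 2⟪∇_hV₂,∂₂V_h⟫ + ω₂²`
this is the coercive enstrophy law of the record:
`a₁(φ_g) = ∫g′[ (3/2)|∂₂V_h|² + ½ω₂² − ½|∇_hV₂|² − ⟪∇_hV₂,∂₂V_h⟫ ] + ∫g″[⟪V_h,∂₂V_h⟫ − ⟪V_h,∇_hV₂⟫]`, whose `g″`-part is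
`−½∫g‴(‖V‖² − 2V₂²)` after two more integrations by parts (next file).

WHAT THIS IS NOT: K1b is NOT proved; nothing here proves NS regularity. [folklore]
-/

noncomputable section

open Set Filter Topology MeasureTheory Metric Function InnerProductSpace
open scoped ENNReal NNReal Topology InnerProductSpace RealInnerProductSpace ContDiff
open Literature.Analysis.FluidPDE Literature.Analysis

namespace Summit.NavierStokesRegularity.NavierStokesRegularity.Theorems

-- the problem directory repeats the summit name (`NavierStokesRegularity/NavierStokesRegularity`)
set_option linter.dupNamespace false

namespace ExtremiserLiouville

open DepletionLadder.KStar

variable {V : EuclideanSpace ℝ (Fin 3) → EuclideanSpace ℝ (Fin 3)} {g : ℝ → ℝ}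

/-! ## 1. `curl ∂₂V = ∂₂ curl V` -/

/-- Components of the derivative of the curl: `(D(curl V)(x) v)ᵢ` is the corresponding difference of mixed second
derivatives, e.g. `(D(curl V) v)₀ = (D(∂_vV) e₁)₂ − (D(∂_vV) e₂)₁`; i.e. **`∂_v curl V = curl ∂_vV`** for `V ∈ C²`. [folklore] -/
theorem curl_fderiv_apply_comm (hV : ContDiff ℝ 2 V) (x v : EuclideanSpace ℝ (Fin 3)) :
    curl (fun y => fderiv ℝ V y v) x = fderiv ℝ (curl V) x v := by
  have hD : ∀ w : EuclideanSpace ℝ (Fin 3), Differentiable ℝ fun y => fderiv ℝ V y w := fun w =>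
    ((hV.fderiv_right (m := 1) (by norm_num)).differentiable one_ne_zero).clm_apply (differentiable_const w)
  have hDi : ∀ (w : EuclideanSpace ℝ (Fin 3)) (i : Fin 3), Differentiable ℝ fun y => fderiv ℝ V y w i := fun w i =>
    contDiff_apply_coord_vec3 (n := 1) ((contDiff_fderiv_apply_const_succ (n := 1) (by exact_mod_cast hV) w)) i
      |>.differentiable one_ne_zero
  have hcurl1 : ContDiff ℝ 1 (curl V) := contDiff_curl (n := 1) (by exact_mod_cast hV)
  have hcd : Differentiable ℝ (curl V) := hcurl1.differentiable one_ne_zero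
  -- coordinates of the right-hand side
  have hR : ∀ i : Fin 3, fderiv ℝ (curl V) x v i = fderiv ℝ (fun y => curl V y i) x v := by
    intro i
    have h : HasFDerivAt (fun y => curl V y i)
        ((EuclideanSpace.proj i : EuclideanSpace ℝ (Fin 3) →L[ℝ] ℝ).comp (fderiv ℝ (curl V) x)) x :=
      (EuclideanSpace.proj i : EuclideanSpace ℝ (Fin 3) →L[ℝ] ℝ).hasFDerivAt.comp x (hcd x).hasFDerivAt
    rw [h.fderiv]; rfl
  -- the mixed partials, componentwise
  have hM : ∀ (w : EuclideanSpace ℝ (Fin 3)) (i : Fin 3),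
      fderiv ℝ (fun y => fderiv ℝ V y w i) x v = fderiv ℝ (fun y => fderiv ℝ V y v) x w i := by
    intro w i
    have h : HasFDerivAt (fun y => fderiv ℝ V y w i)
        ((EuclideanSpace.proj i : EuclideanSpace ℝ (Fin 3) →L[ℝ] ℝ).comp (fderiv ℝ (fun y => fderiv ℝ V y w) x)) x :=
      (EuclideanSpace.proj i : EuclideanSpace ℝ (Fin 3) →L[ℝ] ℝ).hasFDerivAt.comp x ((hD w) x).hasFDerivAt
    rw [h.fderiv, ContinuousLinearMap.comp_apply, fderiv_fderiv_apply_comm_vec hV x w v]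
    rfl
  -- the three coordinate functions of `curl V`
  have e0 : (fun y => curl V y 0) = fun y => fderiv ℝ V y (EuclideanSpace.single 1 1) 2 - fderiv ℝ V y (EuclideanSpace.single 2 1) 1 := by
    funext y; simp [curl]
  have e1 : (fun y => curl V y 1) = fun y => fderiv ℝ V y (EuclideanSpace.single 2 1) 0 - fderiv ℝ V y (EuclideanSpace.single 0 1) 2 := by
    funext y; simp [curl]
  have e2 : (fun y => curl V y 2) = fun y => fderiv ℝ V y (EuclideanSpace.single 0 1) 1 - fderiv ℝ V y (EuclideanSpace.single 1 1) 0 := by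
    funext y; simp [curl]
  ext i
  fin_cases i
  · show curl (fun y => fderiv ℝ V y v) x 0 = fderiv ℝ (curl V) x v 0
    rw [hR, e0, fderiv_fun_sub ((hDi _ _) x) ((hDi _ _) x), sub_apply, hM, hM]
    simp [curl]
  · show curl (fun y => fderiv ℝ V y v) x 1 = fderiv ℝ (curl V) x v 1
    rw [hR, e1, fderiv_fun_sub ((hDi _ _) x) ((hDi _ _) x), sub_apply, hM, hM]
    simp [curl]
  · show curl (fun y => fderiv ℝ V y v) x 2 = fderiv ℝ (curl V) x v 2
    rw [hR, e2, fderiv_fun_sub ((hDi _ _) x) ((hDi _ _) x), sub_apply, hM, hM]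
    simp [curl]

/-! ## 2. The curl of the generator and its pairing with the vorticity -/

/-- **`⟪ω, curl φ_g⟫` pointwise.**  For `V, g ∈ C²`, with `e₂ = (0,0,1)`, `P = ∂₂V = DV e₂`, `ω = curl V`:
`⟪ω(x), curl(g(x₂)∂₂V + g′(x₂)(V − V₂e₂))(x)⟫ = g(x₂)⟪ω, curl ∂₂V⟫ + g′(x₂)(2(P₀²+P₁²) − 2(∂₀V₂P₀ + ∂₁V₂P₁) + ω₂²)
 + g″(x₂)((V₀P₀ + V₁P₁) − (V₀∂₀V₂ + V₁∂₁V₂))`. [folklore] -/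
theorem inner_curl_slideGenerator (hV : ContDiff ℝ 2 V) (hg : ContDiff ℝ 2 g) (x : EuclideanSpace ℝ (Fin 3)) :
    ⟪curl V x, curl (fun y : EuclideanSpace ℝ (Fin 3) =>
        g (y 2) • fderiv ℝ V y (EuclideanSpace.single (2 : Fin 3) (1 : ℝ)) +
          deriv g (y 2) • (V y - (V y 2) • EuclideanSpace.single (2 : Fin 3) (1 : ℝ))) x⟫ =
      g (x 2) * ⟪curl V x, curl (fun y => fderiv ℝ V y (EuclideanSpace.single (2 : Fin 3) (1 : ℝ))) x⟫ +
        deriv g (x 2) *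
          (2 * (fderiv ℝ V x (EuclideanSpace.single 2 1) 0 ^ 2 + fderiv ℝ V x (EuclideanSpace.single 2 1) 1 ^ 2) -
            2 * (fderiv ℝ V x (EuclideanSpace.single 0 1) 2 * fderiv ℝ V x (EuclideanSpace.single 2 1) 0 +
              fderiv ℝ V x (EuclideanSpace.single 1 1) 2 * fderiv ℝ V x (EuclideanSpace.single 2 1) 1) +
            curl V x 2 ^ 2) +
        deriv (deriv g) (x 2) *
          ((V x 0 * fderiv ℝ V x (EuclideanSpace.single 2 1) 0 + V x 1 * fderiv ℝ V x (EuclideanSpace.single 2 1) 1) -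
            (V x 0 * fderiv ℝ V x (EuclideanSpace.single 0 1) 2 + V x 1 * fderiv ℝ V x (EuclideanSpace.single 1 1) 2)) := by
  set e₂ : EuclideanSpace ℝ (Fin 3) := EuclideanSpace.single (2 : Fin 3) (1 : ℝ) with he₂
  have hVd : Differentiable ℝ V := hV.differentiable two_ne_zero
  have hgd : Differentiable ℝ g := hg.differentiable two_ne_zero
  have hg'c : ContDiff ℝ 1 (deriv g) := by
    have h2 : ContDiff ℝ (1 + 1) g := by rw [show ((1 : WithTop ℕ∞) + 1) = 2 by norm_num]; exact hg
    exact h2.deriv'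
  have hg'd : Differentiable ℝ (deriv g) := hg'c.differentiable one_ne_zero
  set a : EuclideanSpace ℝ (Fin 3) → ℝ := fun y => g (y 2) with ha
  set b : EuclideanSpace ℝ (Fin 3) → ℝ := fun y => deriv g (y 2) with hb
  set Pf : EuclideanSpace ℝ (Fin 3) → EuclideanSpace ℝ (Fin 3) := fun y => fderiv ℝ V y e₂ with hPf
  set W : EuclideanSpace ℝ (Fin 3) → EuclideanSpace ℝ (Fin 3) := fun y => V y - (V y 2) • e₂ with hW
  have haD : HasFDerivAt a (deriv g (x 2) • (EuclideanSpace.proj (2 : Fin 3) : EuclideanSpace ℝ (Fin 3) →L[ℝ] ℝ)) x :=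
    hasFDerivAt_comp_coord hgd 2 x
  have hbD : HasFDerivAt b (deriv (deriv g) (x 2) • (EuclideanSpace.proj (2 : Fin 3) : EuclideanSpace ℝ (Fin 3) →L[ℝ] ℝ)) x :=
    hasFDerivAt_comp_coord hg'd 2 x
  have hPd : Differentiable ℝ Pf :=
    ((hV.fderiv_right (m := 1) (by norm_num)).differentiable one_ne_zero).clm_apply (differentiable_const e₂)
  have hPD : HasFDerivAt Pf (fderiv ℝ Pf x) x := (hPd x).hasFDerivAt
  have hV2 : HasFDerivAt (fun z => V z 2)
      ((EuclideanSpace.proj (2 : Fin 3) : EuclideanSpace ℝ (Fin 3) →L[ℝ] ℝ).comp (fderiv ℝ V x)) x :=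
    (EuclideanSpace.proj (2 : Fin 3) : EuclideanSpace ℝ (Fin 3) →L[ℝ] ℝ).hasFDerivAt.comp x (hVd x).hasFDerivAt
  have hWD : HasFDerivAt W (fderiv ℝ V x -
      (((EuclideanSpace.proj (2 : Fin 3) : EuclideanSpace ℝ (Fin 3) →L[ℝ] ℝ).comp (fderiv ℝ V x)).smulRight e₂)) x := by
    have h1 : HasFDerivAt (fun z => (V z 2) • e₂)
        ((((EuclideanSpace.proj (2 : Fin 3) : EuclideanSpace ℝ (Fin 3) →L[ℝ] ℝ).comp (fderiv ℝ V x)).smulRight e₂)) x :=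
      hV2.smul_const e₂
    exact (hVd x).hasFDerivAt.sub h1
  have h1 : HasFDerivAt (fun y => a y • Pf y)
      (a x • fderiv ℝ Pf x + (deriv g (x 2) • (EuclideanSpace.proj (2 : Fin 3) : EuclideanSpace ℝ (Fin 3) →L[ℝ] ℝ)).smulRight (Pf x)) x :=
    haD.smul hPD
  have h2 : HasFDerivAt (fun y => b y • W y)
      (b x • (fderiv ℝ V x -
        (((EuclideanSpace.proj (2 : Fin 3) : EuclideanSpace ℝ (Fin 3) →L[ℝ] ℝ).comp (fderiv ℝ V x)).smulRight e₂)) +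
        (deriv (deriv g) (x 2) • (EuclideanSpace.proj (2 : Fin 3) : EuclideanSpace ℝ (Fin 3) →L[ℝ] ℝ)).smulRight (W x)) x :=
    hbD.smul hWD
  have hφ : HasFDerivAt (fun y => a y • Pf y + b y • W y)
      ((a x • fderiv ℝ Pf x + (deriv g (x 2) • (EuclideanSpace.proj (2 : Fin 3) : EuclideanSpace ℝ (Fin 3) →L[ℝ] ℝ)).smulRight (Pf x)) +
        (b x • (fderiv ℝ V x -
          (((EuclideanSpace.proj (2 : Fin 3) : EuclideanSpace ℝ (Fin 3) →L[ℝ] ℝ).comp (fderiv ℝ V x)).smulRight e₂)) +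
          (deriv (deriv g) (x 2) • (EuclideanSpace.proj (2 : Fin 3) : EuclideanSpace ℝ (Fin 3) →L[ℝ] ℝ)).smulRight (W x))) x :=
    h1.add h2
  have hfun : (fun y : EuclideanSpace ℝ (Fin 3) => g (y 2) • fderiv ℝ V y e₂ + deriv g (y 2) • (V y - (V y 2) • e₂)) =
      fun y => a y • Pf y + b y • W y := rfl
  rw [hfun]
  -- expand everything in coordinates
  have hDφ := hφ.fderiv
  simp only [PiLp.inner_apply, RCLike.inner_apply, conj_trivial, Fin.sum_univ_three]
  simp only [curl]
  rw [hDφ]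
  simp [ha, hb, hW, he₂]
  ring

end ExtremiserLiouville

end Summit.NavierStokesRegularity.NavierStokesRegularity.Theorems

end
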